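import Summits.Ventures.HodgeKum4.Theorems.KummerFixedLocusMeetsTranslatesLocal
import Literature.AlgebraicGeometry.Hyperkaehler.GeneralizedKummerTypeTranslationFixedPoints
import HarnessLib

/-!
# Route A ON `X`, BY NAME: I1geo (all `X`) and `HC_Kum4Type ∧ HC_Kum4TypePowers` from the named fact
# F125X «`Fix(g) = 125` reduced points on every `X` of `Kum⁴`-type» (cell `hodge-kum4`, seat p2 g6)

HONEST FRAMING.  Nothing here proves I1geo, `HC_Kum4Type` or the Hodge conjecture outright.  Every
theorem is CONDITIONAL on the printed statements it names — named Literature facts taken as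
hypotheses — and, where stated, on p1's cell lemma L1.  This file is the by-name closer ordered by the
director (2026-08-26T13:08:38Z «GO R-A‴-1», step (d)): the theorems of
`KummerFixedLocusMeetsTranslatesLocal` (p446589), whose split hypothesis `hsplitX` was an INLINE
binder, applied to the named fact
`Hyperkaehler.HassettTschinkel2013_Oguiso2020_fixedPointScheme_translation_kum4Type` («F125X»:
Hassett–Tschinkel 2013 Thm. 2.1 ⊕ Oguiso 2020 Prop. 3.5–3.6 ⊕ fixed loci of `Aut₀` deform, as in
Floccari 2024 proof of Lemma 2.2 ⊕ Conrad–Gabber–Prasad A.8.10(2); grade PRINT-SYNTHESIS, immediately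
implied; file `Literature/AlgebraicGeometry/Hyperkaehler/GeneralizedKummerTypeTranslationFixedPoints`),
whose body is that binder verbatim — so every proof below is a one-line application.

WHAT IS PROVED (all CONDITIONAL):
* `kum4FixedFourfoldMeetsTranslates_of_split125` — the route's ORIGINAL residual I1geo
  `Kum4FixedFourfoldMeetsTranslates` (every `X` of `Kum⁴`-type) from THREE named facts: `Γ ≅ (ℤ/5)⁴`
  (Floccari–Varesco, REFEREED), the tangent-dimension fact (Milne 13.1 / CGP A.8.10 / GW 6.28,
  REFEREED textbook) and F125X (PRINT-SYNTHESIS).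
* `hc_kum4Type_of_L1_of_split125` — `HC_Kum4Type ∧ HC_Kum4TypePowers` from SIXTEEN binders = FIFTEEN
  named Literature facts (FOURTEEN REFEREED: the twelve of `hc_kum4Type_of_L1_of_meetsTranslates`,
  `Γ ≅ (ℤ/5)⁴`, the tangent-dimension fact; ONE PRINT-SYNTHESIS: F125X) + L1.  NO cohomological
  transport (T), NO Kummer-point statement (Oguiso-at-`K`, (H2), (H3), COUNT) among the inputs.
* `oguiso2020_fixedPointScheme_of_split125` — F125X SPECIALISES to Oguiso's record at the Kummer
  varieties `K⁴(A)` (a smooth projective `K⁴(A)` is of `Kum⁴`-type: it carries a Hodge model); kernel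
  glue documenting that F125X is the stronger statement.
* `kum4FixedFourfoldMeetsTranslatesAtKummer_of_split125` — the restricted residual at `K⁴(A)` from
  FV + F125X + the tangent-dimension fact (through the specialisation).
Rung currency (the cell's words are the director's, not this file's): bill A‴ = 14 REFEREED + F125X +
L1 for `HC_Kum4Type ∧ HC_Kum4TypePowers`; the (T)-chain (`…KummerPointTransport`, p424699/p430760) and
the Kummer-point chain A′ (`…TransitiveTangent`, p442732) stay landed as alternative derivations.
-/

noncomputable section

open CategoryTheory CategoryTheory.Limits MonoidalCategory
open Literature.AlgebraicGeometry Literature.AlgebraicGeometry.Motives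
open Literature.AlgebraicGeometry.Hyperkaehler Literature.AlgebraicGeometry.GroupActions
open Literature.AlgebraicGeometry.HodgeTheory

namespace Summit.Ventures.HodgeKum4

/-- **I1geo `Kum4FixedFourfoldMeetsTranslates` (all `X` of `Kum⁴`-type) from three named facts**:
`Γ ≅ (ℤ/5)⁴` (Floccari–Varesco, REFEREED), the tangent-dimension fact (REFEREED textbook) and F125X
«every fixed-point scheme of `⟨g⟩`, `g ∈ Γ(X) ∖ 1`, is `125` reduced points» (PRINT-SYNTHESIS) — the
theorem `kum4FixedFourfoldMeetsTranslates_of_fixedPointsSplit` with its inline split hypothesis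
supplied BY NAME.  CONDITIONAL on the three statements; nothing is proved outright. -/
theorem kum4FixedFourfoldMeetsTranslates_of_split125
    (hFV : FloccariVaresco2024_autFixingH2H3_equiv_kumType)
    (hTan : GroupActions.Milne2017_fixedComponent_dim_eq_finrank_tangentFixed)
    (h125 : HassettTschinkel2013_Oguiso2020_fixedPointScheme_translation_kum4Type) :
    Kum4FixedFourfoldMeetsTranslates :=
  kum4FixedFourfoldMeetsTranslates_of_fixedPointsSplit hFV hTan h125

/-- **H3 for `Kum⁴`-type and its powers from FIFTEEN NAMED FACTS + L1** — sixteen binders: FOURTEEN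
REFEREED named facts (the twelve of `hc_kum4Type_of_L1_of_meetsTranslates`, `Γ ≅ (ℤ/5)⁴`, the
tangent-dimension fact), ONE PRINT-SYNTHESIS named fact (F125X:
`HassettTschinkel2013_Oguiso2020_fixedPointScheme_translation_kum4Type`) and p1's cell lemma L1
`LefschetzGenerationKum4`.  The theorem `hc_kum4Type_of_L1_of_fixedPointsSplit` with its inline split
hypothesis supplied BY NAME; NO transport (T), NO Kummer-point input, NO (H2).  CONDITIONAL on all
sixteen; nothing here says `HC_Kum4Type` or the Hodge conjecture is proved outright. -/
theorem hc_kum4Type_of_L1_of_split125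
    (hOGV : OGradyVoisin2022_thirdJacobian_kugaSatake_kummerType)
    (hFF : FloccariFu2026_hodgeClasses_algebraic_powers_discOneWeilFourfold)
    (hFo : Foster2024_lefschetzStandard_kummerType_prime)
    (hAn : Andre1996_dualLefschetz_mem_adjoin_lefschetzInvolution)
    (hA1 : Hirzebruch1969_gSignature_involution_halfDimFixedLocus)
    (hA2 : Floccari2026_fixedFourfold_kum4Type)
    (hHIR : Voisin2002_hodgeIndex_hodgeRiemann_middle)
    (hGS : GoettscheSoergel1993_chiY_kum4Type)
    (hGK : GreenKimLazaRobles2022_llvTrivial_isOfHodgeType_kumType)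
    (hF : Foster2024_translationAction_kum4Type)
    (hcardF : Floccari2026_card_autFixingH2H3_kum4Type)
    (hFu : Fulton1998_cupPairing_transversalPoint)
    (hFV : FloccariVaresco2024_autFixingH2H3_equiv_kumType)
    (hTan : GroupActions.Milne2017_fixedComponent_dim_eq_finrank_tangentFixed)
    (h125 : HassettTschinkel2013_Oguiso2020_fixedPointScheme_translation_kum4Type)
    (hL1 : LefschetzGenerationKum4) :
    Summit.Ventures.HodgeKum4.HC_Kum4Type ∧ Summit.Ventures.HodgeKum4.HC_Kum4TypePowers :=
  hc_kum4Type_of_L1_of_fixedPointsSplit hOGV hFF hFo hAn hA1 hA2 hHIR hGS hGK hF hcardF hFu hFV hTan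
    h125 hL1

/-- **F125X specialises to Oguiso 2020 Prop. 3.5–3.6 at the Kummer varieties**: a smooth projective
generalized Kummer variety `K⁴(A)` of an abelian surface carries a Hodge model
(`HodgeTheory.nonempty_hodgeModel_holds`, PROVED in the tree), hence is of `Kum⁴`-type
(`IsOfGeneralizedKummerType.of_hodgeModel`), so F125X yields
`Oguiso2020_fixedPointScheme_translation_generalizedKummerFour`.  Kernel glue only: it documents that
F125X is the STRONGER statement (same inner statement, wider outer quantifier), not a restatement. -/
theorem oguiso2020_fixedPointScheme_of_split125
    (h125 : HassettTschinkel2013_Oguiso2020_fixedPointScheme_translation_kum4Type) :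
    Oguiso2020_fixedPointScheme_translation_generalizedKummerFour := by
  intro A K hA hKum hK8 g hg F j hj
  obtain ⟨M⟩ := HodgeTheory.nonempty_hodgeModel_holds (n := 8) (X := K) hK8
  exact h125 hK8 (IsOfGeneralizedKummerType.of_hodgeModel (n := 4) hA hKum hK8 M) g hg j hj

/-- **The restricted residual at `K⁴(A)` from FV + F125X + the tangent-dimension fact** —
`kum4FixedFourfoldMeetsTranslatesAtKummer_of_split_oguiso` fed the specialisation
`oguiso2020_fixedPointScheme_of_split125`.  CONDITIONAL on the three statements. -/
theorem kum4FixedFourfoldMeetsTranslatesAtKummer_of_split125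
    (hFV : FloccariVaresco2024_autFixingH2H3_equiv_kumType)
    (hTan : GroupActions.Milne2017_fixedComponent_dim_eq_finrank_tangentFixed)
    (h125 : HassettTschinkel2013_Oguiso2020_fixedPointScheme_translation_kum4Type) :
    Kum4FixedFourfoldMeetsTranslatesAtKummer :=
  kum4FixedFourfoldMeetsTranslatesAtKummer_of_split_oguiso hFV
    (oguiso2020_fixedPointScheme_of_split125 h125) hTan

end Summit.Ventures.HodgeKum4

end
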